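import Summits.NavierStokesRegularity.NavierStokesRegularity.Theorems.TypeILiouvilleAxisTestDoor

/-!
# TypeILiouvilleAxisTest (part 2: the cuts and AXL) — decomp-ns ROOT CELL, lens 2 «structural dichotomy (special vs generic)», generation 23

Continuation of `Theorems/TypeILiouvilleAxisTestDoor.lean` (§1–§3 there; the full NODE «THE AXIS TEST» description is in that file's docstring):

* §4 **THE CUTS LOCALISE TO 𝒜** (excluded middle on the Type-I ceiling, field by field):
  L_Q|𝒜 ⟺ SQL|𝒜 (`quiescentLiouville_onAxis_iff_slow`), BCL|𝒜 ⟺ SFL|𝒜 (`bcl_onAxis_iff_sfl`);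
  hence EXACTLY `L_Q ⟺ SQL|𝒜 ∧ L_Q|off-axis` (`quiescentLiouville_iff_axisTest`) and
  **(L) ⟺ EL ∧ SQL|𝒜 ∧ L_Q|off-axis** (`liouvilleL_iff_axisTest`, via the landed exact iff);
* §5 **THE SPECIAL CELL OF (L) IS A NAMED OPEN PROBLEM**: AXL «infinitesimally axisymmetric bounded ancient
  mild solutions are constant» = the Koch–Nadirashvili–Seregin–Šverák axisymmetric Liouville conjecture
  (KNSS 2009 p. 10: "The validity of Theorem 5.2 in the absence of the 'no swirl' assumption is still an
  open problem"; Lei–Ren–Zhang arXiv:1911.01571 p. 3: "[KNSS] conjectured that bounded mild ancient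
  solutions of axi-symmetric Navier–Stokes equations are constants"); in kernel: (L) ⟺ AXL ∧ (L)|off-axis
  (`liouvilleL_iff_axl_and_offAxis`, pointwise), AXL ⟹ SQL|𝒜 (`slowOnAxis_of_axl`) and
  EL ∧ SQL|𝒜 ⟹ AXL (`axl_of_eternal_and_slowOnAxis`, the non-quiescent axisymmetric fields being killed
  by ETERNAL LIOUVILLE through the landed shadow `shadowExtraction_holds`). Its rungs in the tree:
  KNSS Thm 5.2 (`Literature…knss_axisymmetric_no_swirl_holds`), the Type-I-in-time cell (item 14061, and
  now `tfl_onAxis`), KNSS Thm 5.3 (`knss_bound_C_over_r_*`); in print beyond the tree: Lei–Ren–Zhang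
  Thm 1 (periodic in `z`, `Γ` bounded);

Helper for stmt-NavierStokesRegularity-10661 (`--supports … --as helper`); closes no item; no `def`, no `sorry`, statements INLINE over tree declarations. The lens file's §6 «root reach» is not landed (closure-modulo only).
[cite: KochNadirashviliSereginSverak2009, Thm 5.2, p. 10 open problem, Lemma 6.1 (arXiv:0709.3599)]
[cite: LeiRenZhang2019, Thm 1 and p. 3 (arXiv:1911.01571)]
-/

noncomputable section

-- the summit and its single problem share the name `NavierStokesRegularity` (D-0017 nested layout)
set_option linter.dupNamespace false
set_option maxHeartbeats 800000

open MeasureTheory Set Function Filter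
open scoped Topology
open Literature.Analysis.FluidPDE

namespace Summit.NavierStokesRegularity.NavierStokesRegularity.Theorems.TypeILiouvilleAxisTest

open Summit.NavierStokesRegularity.NavierStokesRegularity.Theorems.TypeILiouvilleAxisTestDoor

/-! ## §4 The cuts localise to 𝒜: L_Q|𝒜 ⟺ SQL|𝒜, BCL|𝒜 ⟺ SFL|𝒜; L_Q ⟺ SQL|𝒜 ∧ L_Q|off-axis; (L) ⟺ EL ∧ SQL|𝒜 ∧ L_Q|off-axis -/

section Cut

/-- **L_Q|𝒜 ⟺ SQL|𝒜**: on the axisymmetric class QUIESCENT LIOUVILLE is exactly its SLOW stratum (the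
Type-I-rate stratum being closed by `tfl_onAxis`; excluded middle on the Type-I ceiling, field by field).
[cite: KochNadirashviliSereginSverak2009, Thm 5.2 and p. 10 (arXiv:0709.3599)] -/
theorem quiescentLiouville_onAxis_iff_slow :
    (∀ v : ℝ → EuclideanSpace ℝ (Fin 3) → EuclideanSpace ℝ (Fin 3),
      ContinuousOn (uncurry v) (Iio 0 ×ˢ univ) →
      (∃ K : ℝ, ∀ t < 0, ∀ x, ‖v t x‖ ≤ K) →
      (∀ t < 0, Literature.Analysis.FluidPDE.IsWeaklyDivFree (v t)) →
      (∀ s t : ℝ, s < t → t < 0 → ∀ x,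
        v t x = Literature.Analysis.UnboundedOperators.heatExtension (v s) (t - s) x -
          Literature.Analysis.FluidPDE.oseenDuhamel 1 s v v t x) →
      (∃ (a : EuclideanSpace ℝ (Fin 3)) (A : EuclideanSpace ℝ (Fin 3) →L[ℝ] EuclideanSpace ℝ (Fin 3)),
        (∀ x, inner ℝ (A x) x = 0) ∧ A ≠ 0 ∧
          ∀ t < 0, ∀ x, fderiv ℝ (v t) x (A (x - a)) - A (v t x) = 0) →
      (∀ ε : ℝ, 0 < ε → ∃ T : ℝ, T < 0 ∧ ∀ t < T, ∀ x y : EuclideanSpace ℝ (Fin 3),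
        dist x y ≤ 1 → ‖v t x - v t y‖ ≤ ε) →
      ∃ b : EuclideanSpace ℝ (Fin 3), ∀ t < 0, ∀ x, v t x = b) ↔
    (∀ v : ℝ → EuclideanSpace ℝ (Fin 3) → EuclideanSpace ℝ (Fin 3),
      ContinuousOn (uncurry v) (Iio 0 ×ˢ univ) →
      (∃ K : ℝ, ∀ t < 0, ∀ x, ‖v t x‖ ≤ K) →
      (∀ t < 0, Literature.Analysis.FluidPDE.IsWeaklyDivFree (v t)) →
      (∀ s t : ℝ, s < t → t < 0 → ∀ x,
        v t x = Literature.Analysis.UnboundedOperators.heatExtension (v s) (t - s) x -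
          Literature.Analysis.FluidPDE.oseenDuhamel 1 s v v t x) →
      (∃ (a : EuclideanSpace ℝ (Fin 3)) (A : EuclideanSpace ℝ (Fin 3) →L[ℝ] EuclideanSpace ℝ (Fin 3)),
        (∀ x, inner ℝ (A x) x = 0) ∧ A ≠ 0 ∧
          ∀ t < 0, ∀ x, fderiv ℝ (v t) x (A (x - a)) - A (v t x) = 0) →
      (∀ ε : ℝ, 0 < ε → ∃ T : ℝ, T < 0 ∧ ∀ t < T, ∀ x y : EuclideanSpace ℝ (Fin 3),
        dist x y ≤ 1 → ‖v t x - v t y‖ ≤ ε) →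
      (∀ (c : EuclideanSpace ℝ (Fin 3)) (C : ℝ), ∃ t : ℝ, t < 0 ∧ ∃ x,
        C < Real.sqrt (-t) * ‖v t x - c‖) →
      ∃ b : EuclideanSpace ℝ (Fin 3), ∀ t < 0, ∀ x, v t x = b) := by
  refine ⟨fun hQ v hc hK hd hm hax hq _ => hQ v hc hK hd hm hax hq, fun hS v hc hK hd hm hax hq => ?_⟩
  by_cases hI : ∃ (c : EuclideanSpace ℝ (Fin 3)) (C : ℝ), ∀ t < 0, ∀ x,
      Real.sqrt (-t) * ‖v t x - c‖ ≤ C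
  · exact tfl_onAxis v hc hK hd hm hax hI
  · push Not at hI
    exact hS v hc hK hd hm hax hq hI

/-- **BCL|𝒜 ⟺ SFL|𝒜**: on the axisymmetric class BACKWARD-CONVERGENT LIOUVILLE (g21's door) is exactly its
slow stratum SFL. [cite: KochNadirashviliSereginSverak2009, Thm 5.2 and p. 10 (arXiv:0709.3599)] -/
theorem bcl_onAxis_iff_sfl :
    (∀ v : ℝ → EuclideanSpace ℝ (Fin 3) → EuclideanSpace ℝ (Fin 3),
      ContinuousOn (uncurry v) (Iio 0 ×ˢ univ) →
      (∃ K : ℝ, ∀ t < 0, ∀ x, ‖v t x‖ ≤ K) →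
      (∀ t < 0, Literature.Analysis.FluidPDE.IsWeaklyDivFree (v t)) →
      (∀ s t : ℝ, s < t → t < 0 → ∀ x,
        v t x = Literature.Analysis.UnboundedOperators.heatExtension (v s) (t - s) x -
          Literature.Analysis.FluidPDE.oseenDuhamel 1 s v v t x) →
      (∃ (a : EuclideanSpace ℝ (Fin 3)) (A : EuclideanSpace ℝ (Fin 3) →L[ℝ] EuclideanSpace ℝ (Fin 3)),
        (∀ x, inner ℝ (A x) x = 0) ∧ A ≠ 0 ∧
          ∀ t < 0, ∀ x, fderiv ℝ (v t) x (A (x - a)) - A (v t x) = 0) →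
      (∃ c : EuclideanSpace ℝ (Fin 3), ∀ η : ℝ, 0 < η → ∃ T : ℝ, T < 0 ∧ ∀ t < T, ∀ x,
        ‖v t x - c‖ ≤ η) →
      ∃ b : EuclideanSpace ℝ (Fin 3), ∀ t < 0, ∀ x, v t x = b) ↔
    (∀ v : ℝ → EuclideanSpace ℝ (Fin 3) → EuclideanSpace ℝ (Fin 3),
      ContinuousOn (uncurry v) (Iio 0 ×ˢ univ) →
      (∃ K : ℝ, ∀ t < 0, ∀ x, ‖v t x‖ ≤ K) →
      (∀ t < 0, Literature.Analysis.FluidPDE.IsWeaklyDivFree (v t)) →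
      (∀ s t : ℝ, s < t → t < 0 → ∀ x,
        v t x = Literature.Analysis.UnboundedOperators.heatExtension (v s) (t - s) x -
          Literature.Analysis.FluidPDE.oseenDuhamel 1 s v v t x) →
      (∃ (a : EuclideanSpace ℝ (Fin 3)) (A : EuclideanSpace ℝ (Fin 3) →L[ℝ] EuclideanSpace ℝ (Fin 3)),
        (∀ x, inner ℝ (A x) x = 0) ∧ A ≠ 0 ∧
          ∀ t < 0, ∀ x, fderiv ℝ (v t) x (A (x - a)) - A (v t x) = 0) →
      (∃ c : EuclideanSpace ℝ (Fin 3), ∀ η : ℝ, 0 < η → ∃ T : ℝ, T < 0 ∧ ∀ t < T, ∀ x,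
        ‖v t x - c‖ ≤ η) →
      (∀ (c : EuclideanSpace ℝ (Fin 3)) (C : ℝ), ∃ t : ℝ, t < 0 ∧ ∃ x,
        C < Real.sqrt (-t) * ‖v t x - c‖) →
      ∃ b : EuclideanSpace ℝ (Fin 3), ∀ t < 0, ∀ x, v t x = b) := by
  refine ⟨fun hB v hc hK hd hm hax hbc _ => hB v hc hK hd hm hax hbc, fun hS v hc hK hd hm hax hbc => ?_⟩
  by_cases hI : ∃ (c : EuclideanSpace ℝ (Fin 3)) (C : ℝ), ∀ t < 0, ∀ x,
      Real.sqrt (-t) * ‖v t x - c‖ ≤ C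
  · exact tfl_onAxis v hc hK hd hm hax hI
  · push Not at hI
    exact hS v hc hK hd hm hax hbc hI

/-- **EXACTNESS: L_Q ⟺ SQL|𝒜 ∧ L_Q|off-axis** — THE AXIS TEST on the residual of record: QUIESCENT
LIOUVILLE is the conjunction of its SLOW AXISYMMETRIC cell and its OFF-AXIS (generic) cell.
[cite: KochNadirashviliSereginSverak2009, Thm 5.2 and p. 10 (arXiv:0709.3599)] -/
theorem quiescentLiouville_iff_axisTest :
    (∀ v : ℝ → EuclideanSpace ℝ (Fin 3) → EuclideanSpace ℝ (Fin 3),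
      ContinuousOn (uncurry v) (Iio 0 ×ˢ univ) →
      (∃ K : ℝ, ∀ t < 0, ∀ x, ‖v t x‖ ≤ K) →
      (∀ t < 0, Literature.Analysis.FluidPDE.IsWeaklyDivFree (v t)) →
      (∀ s t : ℝ, s < t → t < 0 → ∀ x,
        v t x = Literature.Analysis.UnboundedOperators.heatExtension (v s) (t - s) x -
          Literature.Analysis.FluidPDE.oseenDuhamel 1 s v v t x) →
      (∀ ε : ℝ, 0 < ε → ∃ T : ℝ, T < 0 ∧ ∀ t < T, ∀ x y : EuclideanSpace ℝ (Fin 3),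
        dist x y ≤ 1 → ‖v t x - v t y‖ ≤ ε) →
      ∃ b : EuclideanSpace ℝ (Fin 3), ∀ t < 0, ∀ x, v t x = b) ↔
    ((∀ v : ℝ → EuclideanSpace ℝ (Fin 3) → EuclideanSpace ℝ (Fin 3),
      ContinuousOn (uncurry v) (Iio 0 ×ˢ univ) →
      (∃ K : ℝ, ∀ t < 0, ∀ x, ‖v t x‖ ≤ K) →
      (∀ t < 0, Literature.Analysis.FluidPDE.IsWeaklyDivFree (v t)) →
      (∀ s t : ℝ, s < t → t < 0 → ∀ x,
        v t x = Literature.Analysis.UnboundedOperators.heatExtension (v s) (t - s) x -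
          Literature.Analysis.FluidPDE.oseenDuhamel 1 s v v t x) →
      (∃ (a : EuclideanSpace ℝ (Fin 3)) (A : EuclideanSpace ℝ (Fin 3) →L[ℝ] EuclideanSpace ℝ (Fin 3)),
        (∀ x, inner ℝ (A x) x = 0) ∧ A ≠ 0 ∧
          ∀ t < 0, ∀ x, fderiv ℝ (v t) x (A (x - a)) - A (v t x) = 0) →
      (∀ ε : ℝ, 0 < ε → ∃ T : ℝ, T < 0 ∧ ∀ t < T, ∀ x y : EuclideanSpace ℝ (Fin 3),
        dist x y ≤ 1 → ‖v t x - v t y‖ ≤ ε) →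
      (∀ (c : EuclideanSpace ℝ (Fin 3)) (C : ℝ), ∃ t : ℝ, t < 0 ∧ ∃ x,
        C < Real.sqrt (-t) * ‖v t x - c‖) →
      ∃ b : EuclideanSpace ℝ (Fin 3), ∀ t < 0, ∀ x, v t x = b) ∧
    (∀ v : ℝ → EuclideanSpace ℝ (Fin 3) → EuclideanSpace ℝ (Fin 3),
      ContinuousOn (uncurry v) (Iio 0 ×ˢ univ) →
      (∃ K : ℝ, ∀ t < 0, ∀ x, ‖v t x‖ ≤ K) →
      (∀ t < 0, Literature.Analysis.FluidPDE.IsWeaklyDivFree (v t)) →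
      (∀ s t : ℝ, s < t → t < 0 → ∀ x,
        v t x = Literature.Analysis.UnboundedOperators.heatExtension (v s) (t - s) x -
          Literature.Analysis.FluidPDE.oseenDuhamel 1 s v v t x) →
      (¬ ∃ (a : EuclideanSpace ℝ (Fin 3)) (A : EuclideanSpace ℝ (Fin 3) →L[ℝ] EuclideanSpace ℝ (Fin 3)),
        (∀ x, inner ℝ (A x) x = 0) ∧ A ≠ 0 ∧
          ∀ t < 0, ∀ x, fderiv ℝ (v t) x (A (x - a)) - A (v t x) = 0) →
      (∀ ε : ℝ, 0 < ε → ∃ T : ℝ, T < 0 ∧ ∀ t < T, ∀ x y : EuclideanSpace ℝ (Fin 3),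
        dist x y ≤ 1 → ‖v t x - v t y‖ ≤ ε) →
      ∃ b : EuclideanSpace ℝ (Fin 3), ∀ t < 0, ∀ x, v t x = b)) := by
  refine ⟨fun hQ => ⟨fun v hc hK hd hm _ hq _ => hQ v hc hK hd hm hq,
    fun v hc hK hd hm _ hq => hQ v hc hK hd hm hq⟩, fun h v hc hK hd hm hq => ?_⟩
  by_cases hax : ∃ (a : EuclideanSpace ℝ (Fin 3)) (A : EuclideanSpace ℝ (Fin 3) →L[ℝ] EuclideanSpace ℝ (Fin 3)),
      (∀ x, inner ℝ (A x) x = 0) ∧ A ≠ 0 ∧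
        ∀ t < 0, ∀ x, fderiv ℝ (v t) x (A (x - a)) - A (v t x) = 0
  · exact quiescentLiouville_onAxis_iff_slow.2 h.1 v hc hK hd hm hax hq
  · exact h.2 v hc hK hd hm hax hq

/-- **EXACTNESS (unconditional): (L) ⟺ EL ∧ SQL|𝒜 ∧ L_Q|off-axis** — the KNSS crux stmt-10661 is, in the
kernel, ETERNAL LIOUVILLE (stmt-18161) ∧ the SLOW AXISYMMETRIC QUIESCENT cell ∧ the OFF-AXIS QUIESCENT cell
(through the landed exact iff `TypeILiouvilleShadowExtraction.liouvilleL_iff_eternal_and_quiescent_exact`).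
[cite: KochNadirashviliSereginSverak2009, Thm 5.2, Lemma 6.1 and p. 10 (arXiv:0709.3599)] -/
theorem liouvilleL_iff_axisTest :
    Theses.TypeILiouville.TypeIliouvilleL ↔
    (Theses.TypeTwoEternal.EternalLiouville ∧
    (∀ v : ℝ → EuclideanSpace ℝ (Fin 3) → EuclideanSpace ℝ (Fin 3),
      ContinuousOn (uncurry v) (Iio 0 ×ˢ univ) →
      (∃ K : ℝ, ∀ t < 0, ∀ x, ‖v t x‖ ≤ K) →
      (∀ t < 0, Literature.Analysis.FluidPDE.IsWeaklyDivFree (v t)) →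
      (∀ s t : ℝ, s < t → t < 0 → ∀ x,
        v t x = Literature.Analysis.UnboundedOperators.heatExtension (v s) (t - s) x -
          Literature.Analysis.FluidPDE.oseenDuhamel 1 s v v t x) →
      (∃ (a : EuclideanSpace ℝ (Fin 3)) (A : EuclideanSpace ℝ (Fin 3) →L[ℝ] EuclideanSpace ℝ (Fin 3)),
        (∀ x, inner ℝ (A x) x = 0) ∧ A ≠ 0 ∧
          ∀ t < 0, ∀ x, fderiv ℝ (v t) x (A (x - a)) - A (v t x) = 0) →
      (∀ ε : ℝ, 0 < ε → ∃ T : ℝ, T < 0 ∧ ∀ t < T, ∀ x y : EuclideanSpace ℝ (Fin 3),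
        dist x y ≤ 1 → ‖v t x - v t y‖ ≤ ε) →
      (∀ (c : EuclideanSpace ℝ (Fin 3)) (C : ℝ), ∃ t : ℝ, t < 0 ∧ ∃ x,
        C < Real.sqrt (-t) * ‖v t x - c‖) →
      ∃ b : EuclideanSpace ℝ (Fin 3), ∀ t < 0, ∀ x, v t x = b) ∧
    (∀ v : ℝ → EuclideanSpace ℝ (Fin 3) → EuclideanSpace ℝ (Fin 3),
      ContinuousOn (uncurry v) (Iio 0 ×ˢ univ) →
      (∃ K : ℝ, ∀ t < 0, ∀ x, ‖v t x‖ ≤ K) →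
      (∀ t < 0, Literature.Analysis.FluidPDE.IsWeaklyDivFree (v t)) →
      (∀ s t : ℝ, s < t → t < 0 → ∀ x,
        v t x = Literature.Analysis.UnboundedOperators.heatExtension (v s) (t - s) x -
          Literature.Analysis.FluidPDE.oseenDuhamel 1 s v v t x) →
      (¬ ∃ (a : EuclideanSpace ℝ (Fin 3)) (A : EuclideanSpace ℝ (Fin 3) →L[ℝ] EuclideanSpace ℝ (Fin 3)),
        (∀ x, inner ℝ (A x) x = 0) ∧ A ≠ 0 ∧
          ∀ t < 0, ∀ x, fderiv ℝ (v t) x (A (x - a)) - A (v t x) = 0) →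
      (∀ ε : ℝ, 0 < ε → ∃ T : ℝ, T < 0 ∧ ∀ t < T, ∀ x y : EuclideanSpace ℝ (Fin 3),
        dist x y ≤ 1 → ‖v t x - v t y‖ ≤ ε) →
      ∃ b : EuclideanSpace ℝ (Fin 3), ∀ t < 0, ∀ x, v t x = b)) := by
  rw [TypeILiouvilleShadowExtraction.liouvilleL_iff_eternal_and_quiescent_exact]
  exact and_congr_right fun _ => quiescentLiouville_iff_axisTest

end Cut

/-! ## §5 The special cell of (L) is the KNSS axisymmetric Liouville conjecture AXL -/

section Axl

/-- **(L) ⟺ AXL ∧ (L)|off-axis** — THE AXIS TEST on the crux itself (pointwise excluded middle in print's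
class, transported to the registered decl `TypeIliouvilleL` by the landed class bridge
`TypeILiouvilleQuiescentShadow.oseenMild_const_of_liouvilleL'` / `liouvilleL_of_oseenMild_const'`).
AXL «infinitesimally axisymmetric bounded ancient mild solutions are constant» is the
Koch–Nadirashvili–Seregin–Šverák axisymmetric Liouville conjecture.
[cite: KochNadirashviliSereginSverak2009, Thm 5.2 and p. 10 open problem (arXiv:0709.3599)]
[cite: LeiRenZhang2019, p. 3 (arXiv:1911.01571)] -/
theorem liouvilleL_iff_axl_and_offAxis :
    Theses.TypeILiouville.TypeIliouvilleL ↔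
    ((∀ v : ℝ → EuclideanSpace ℝ (Fin 3) → EuclideanSpace ℝ (Fin 3),
      ContinuousOn (uncurry v) (Iio 0 ×ˢ univ) →
      (∃ K : ℝ, ∀ t < 0, ∀ x, ‖v t x‖ ≤ K) →
      (∀ t < 0, Literature.Analysis.FluidPDE.IsWeaklyDivFree (v t)) →
      (∀ s t : ℝ, s < t → t < 0 → ∀ x,
        v t x = Literature.Analysis.UnboundedOperators.heatExtension (v s) (t - s) x -
          Literature.Analysis.FluidPDE.oseenDuhamel 1 s v v t x) →
      (∃ (a : EuclideanSpace ℝ (Fin 3)) (A : EuclideanSpace ℝ (Fin 3) →L[ℝ] EuclideanSpace ℝ (Fin 3)),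
        (∀ x, inner ℝ (A x) x = 0) ∧ A ≠ 0 ∧
          ∀ t < 0, ∀ x, fderiv ℝ (v t) x (A (x - a)) - A (v t x) = 0) →
      ∃ b : EuclideanSpace ℝ (Fin 3), ∀ t < 0, ∀ x, v t x = b) ∧
    (∀ v : ℝ → EuclideanSpace ℝ (Fin 3) → EuclideanSpace ℝ (Fin 3),
      ContinuousOn (uncurry v) (Iio 0 ×ˢ univ) →
      (∃ K : ℝ, ∀ t < 0, ∀ x, ‖v t x‖ ≤ K) →
      (∀ t < 0, Literature.Analysis.FluidPDE.IsWeaklyDivFree (v t)) →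
      (∀ s t : ℝ, s < t → t < 0 → ∀ x,
        v t x = Literature.Analysis.UnboundedOperators.heatExtension (v s) (t - s) x -
          Literature.Analysis.FluidPDE.oseenDuhamel 1 s v v t x) →
      (¬ ∃ (a : EuclideanSpace ℝ (Fin 3)) (A : EuclideanSpace ℝ (Fin 3) →L[ℝ] EuclideanSpace ℝ (Fin 3)),
        (∀ x, inner ℝ (A x) x = 0) ∧ A ≠ 0 ∧
          ∀ t < 0, ∀ x, fderiv ℝ (v t) x (A (x - a)) - A (v t x) = 0) →
      ∃ b : EuclideanSpace ℝ (Fin 3), ∀ t < 0, ∀ x, v t x = b)) := by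
  refine ⟨fun hL => ⟨fun v hc hK hd hm _ =>
      TypeILiouvilleQuiescentShadow.oseenMild_const_of_liouvilleL' hL v hc hK hd hm,
    fun v hc hK hd hm _ => TypeILiouvilleQuiescentShadow.oseenMild_const_of_liouvilleL' hL v hc hK hd hm⟩,
    fun h => TypeILiouvilleQuiescentShadow.liouvilleL_of_oseenMild_const' fun v hc hK hd hm => ?_⟩
  by_cases hax : ∃ (a : EuclideanSpace ℝ (Fin 3)) (A : EuclideanSpace ℝ (Fin 3) →L[ℝ] EuclideanSpace ℝ (Fin 3)),
      (∀ x, inner ℝ (A x) x = 0) ∧ A ≠ 0 ∧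
        ∀ t < 0, ∀ x, fderiv ℝ (v t) x (A (x - a)) - A (v t x) = 0
  · exact h.1 v hc hK hd hm hax
  · exact h.2 v hc hK hd hm hax

/-- **AXL ⟹ SQL|𝒜** (restriction: the slow quiescent axisymmetric cell lies inside AXL).
[cite: KochNadirashviliSereginSverak2009, p. 10 (arXiv:0709.3599)] -/
theorem slowOnAxis_of_axl
    (hAXL : ∀ v : ℝ → EuclideanSpace ℝ (Fin 3) → EuclideanSpace ℝ (Fin 3),
      ContinuousOn (uncurry v) (Iio 0 ×ˢ univ) →
      (∃ K : ℝ, ∀ t < 0, ∀ x, ‖v t x‖ ≤ K) →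
      (∀ t < 0, Literature.Analysis.FluidPDE.IsWeaklyDivFree (v t)) →
      (∀ s t : ℝ, s < t → t < 0 → ∀ x,
        v t x = Literature.Analysis.UnboundedOperators.heatExtension (v s) (t - s) x -
          Literature.Analysis.FluidPDE.oseenDuhamel 1 s v v t x) →
      (∃ (a : EuclideanSpace ℝ (Fin 3)) (A : EuclideanSpace ℝ (Fin 3) →L[ℝ] EuclideanSpace ℝ (Fin 3)),
        (∀ x, inner ℝ (A x) x = 0) ∧ A ≠ 0 ∧
          ∀ t < 0, ∀ x, fderiv ℝ (v t) x (A (x - a)) - A (v t x) = 0) →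
      ∃ b : EuclideanSpace ℝ (Fin 3), ∀ t < 0, ∀ x, v t x = b) :
    ∀ v : ℝ → EuclideanSpace ℝ (Fin 3) → EuclideanSpace ℝ (Fin 3),
      ContinuousOn (uncurry v) (Iio 0 ×ˢ univ) →
      (∃ K : ℝ, ∀ t < 0, ∀ x, ‖v t x‖ ≤ K) →
      (∀ t < 0, Literature.Analysis.FluidPDE.IsWeaklyDivFree (v t)) →
      (∀ s t : ℝ, s < t → t < 0 → ∀ x,
        v t x = Literature.Analysis.UnboundedOperators.heatExtension (v s) (t - s) x -
          Literature.Analysis.FluidPDE.oseenDuhamel 1 s v v t x) →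
      (∃ (a : EuclideanSpace ℝ (Fin 3)) (A : EuclideanSpace ℝ (Fin 3) →L[ℝ] EuclideanSpace ℝ (Fin 3)),
        (∀ x, inner ℝ (A x) x = 0) ∧ A ≠ 0 ∧
          ∀ t < 0, ∀ x, fderiv ℝ (v t) x (A (x - a)) - A (v t x) = 0) →
      (∀ ε : ℝ, 0 < ε → ∃ T : ℝ, T < 0 ∧ ∀ t < T, ∀ x y : EuclideanSpace ℝ (Fin 3),
        dist x y ≤ 1 → ‖v t x - v t y‖ ≤ ε) →
      (∀ (c : EuclideanSpace ℝ (Fin 3)) (C : ℝ), ∃ t : ℝ, t < 0 ∧ ∃ x,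
        C < Real.sqrt (-t) * ‖v t x - c‖) →
      ∃ b : EuclideanSpace ℝ (Fin 3), ∀ t < 0, ∀ x, v t x = b :=
  fun v hc hK hd hm hax _ _ => hAXL v hc hK hd hm hax

/-- **EL ∧ SQL|𝒜 ⟹ AXL**: within 𝒜, a quiescent field is slow or constant (`quiescentLiouville_onAxis_iff_slow`)
and a NON-quiescent one casts a non-constant bounded smooth eternal shadow (`shadowExtraction_holds`,
KNSS Lemma 6.1 compactness) which ETERNAL LIOUVILLE (stmt-18161) forbids. So, modulo EL, the axisymmetric
Liouville conjecture IS its slow quiescent cell. [cite: KochNadirashviliSereginSverak2009, Lemma 6.1 and p. 10 (arXiv:0709.3599)] -/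
theorem axl_of_eternal_and_slowOnAxis (hE : Theses.TypeTwoEternal.EternalLiouville)
    (hS : ∀ v : ℝ → EuclideanSpace ℝ (Fin 3) → EuclideanSpace ℝ (Fin 3),
      ContinuousOn (uncurry v) (Iio 0 ×ˢ univ) →
      (∃ K : ℝ, ∀ t < 0, ∀ x, ‖v t x‖ ≤ K) →
      (∀ t < 0, Literature.Analysis.FluidPDE.IsWeaklyDivFree (v t)) →
      (∀ s t : ℝ, s < t → t < 0 → ∀ x,
        v t x = Literature.Analysis.UnboundedOperators.heatExtension (v s) (t - s) x -
          Literature.Analysis.FluidPDE.oseenDuhamel 1 s v v t x) →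
      (∃ (a : EuclideanSpace ℝ (Fin 3)) (A : EuclideanSpace ℝ (Fin 3) →L[ℝ] EuclideanSpace ℝ (Fin 3)),
        (∀ x, inner ℝ (A x) x = 0) ∧ A ≠ 0 ∧
          ∀ t < 0, ∀ x, fderiv ℝ (v t) x (A (x - a)) - A (v t x) = 0) →
      (∀ ε : ℝ, 0 < ε → ∃ T : ℝ, T < 0 ∧ ∀ t < T, ∀ x y : EuclideanSpace ℝ (Fin 3),
        dist x y ≤ 1 → ‖v t x - v t y‖ ≤ ε) →
      (∀ (c : EuclideanSpace ℝ (Fin 3)) (C : ℝ), ∃ t : ℝ, t < 0 ∧ ∃ x,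
        C < Real.sqrt (-t) * ‖v t x - c‖) →
      ∃ b : EuclideanSpace ℝ (Fin 3), ∀ t < 0, ∀ x, v t x = b) :
    ∀ v : ℝ → EuclideanSpace ℝ (Fin 3) → EuclideanSpace ℝ (Fin 3),
      ContinuousOn (uncurry v) (Iio 0 ×ˢ univ) →
      (∃ K : ℝ, ∀ t < 0, ∀ x, ‖v t x‖ ≤ K) →
      (∀ t < 0, Literature.Analysis.FluidPDE.IsWeaklyDivFree (v t)) →
      (∀ s t : ℝ, s < t → t < 0 → ∀ x,
        v t x = Literature.Analysis.UnboundedOperators.heatExtension (v s) (t - s) x -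
          Literature.Analysis.FluidPDE.oseenDuhamel 1 s v v t x) →
      (∃ (a : EuclideanSpace ℝ (Fin 3)) (A : EuclideanSpace ℝ (Fin 3) →L[ℝ] EuclideanSpace ℝ (Fin 3)),
        (∀ x, inner ℝ (A x) x = 0) ∧ A ≠ 0 ∧
          ∀ t < 0, ∀ x, fderiv ℝ (v t) x (A (x - a)) - A (v t x) = 0) →
      ∃ b : EuclideanSpace ℝ (Fin 3), ∀ t < 0, ∀ x, v t x = b := by
  intro v hc hK hd hm hax
  by_cases hq : ∀ ε : ℝ, 0 < ε → ∃ T : ℝ, T < 0 ∧ ∀ t < T, ∀ x y : EuclideanSpace ℝ (Fin 3),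
      dist x y ≤ 1 → ‖v t x - v t y‖ ≤ ε
  · exact quiescentLiouville_onAxis_iff_slow.2 hS v hc hK hd hm hax hq
  · obtain ⟨V, h1, h2, h3, h4, t, x, y, hne⟩ :=
      TypeILiouvilleShadowExtraction.shadowExtraction_holds v hc hK hd hm hq
    obtain ⟨b, hb⟩ := hE V h1 h2 h3 h4 t
    exact absurd ((hb x).trans (hb y).symm) hne

end Axl

end Summit.NavierStokesRegularity.NavierStokesRegularity.Theorems.TypeILiouvilleAxisTest



end
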